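import Summits.CriticalPhenomena.SAWScalingLimit.Theorems.SAWDefectDecoherenceBoundaryClosureRInnerPolygonsHalfLattice
import HarnessLib

/-!
# Crux `BoundaryClosureR` (stmt-CriticalPhenomena-14004), line `polygon-parity-squeeze`,
# stub `stub_innerPolygons` (IP): zigzag wedges round a point — fans of closed `60°` wedges and
# their interiors in the `halfPlane` language of `ExactPolygonFamily`

Landing target:
`Summits/CriticalPhenomena/SAWScalingLimit/Theorems/SAWDefectDecoherenceBoundaryClosureRInnerPolygonsWedges.lean`
(`--supports stmt-CriticalPhenomena-14004`; FACT 3b of the inner-polygon construction).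

Round a vertex `c` of its boundary cycle the cell set of the inner polygon is, locally, the union of a
contiguous FAN of `j ∈ {1, …, 5}` of the six closed `60°` wedges `W_k(c)` (`…LocalCells`,
`…Fan`), and the polygon itself is locally the INTERIOR of that union.  This file computes these
interiors in the language of `halfPlane k c = {0 < Re((z - c)·conj n_k)}`:

* levels: `level_rel` — `n₄ = n₀ + n₂`, `n₁ = -n₀`, `n₃ = -n₂`, `n₅ = -n₄`, so all six signed
  levels are linear in two of them;
* `interior_closedHalfPlane`, `interior_inter_closedHalfPlane`, `interior_union_closedHalfPlane` —
  interiors of a closed zigzag half-plane, of the intersection of two, of the union of two with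
  distinct boundary lines;
* the fan algebra (`wedge_eq`, `fan_two_eq`, `fan_three_eq`, `fan_four_eq`, `fan_five_eq`): the
  closed wedge `k` is the intersection of the closed half-planes `a k = ![2,3,5,3,2,4]`,
  `b k = ![0,4,0,1,5,1]`; two consecutive wedges from `k` give the closed half-planes
  `![0,3,3,1,2,4] k`, `![4,0,5,5,1,2] k`; three give the closed half-plane `h k = ![0,3,5,1,2,4]`; four give
  `h k ∪ h (k+1)`; five give `h k ∪ h (k+2)` — whence the interiors: `60°/120°` corners are
  `halfPlane ∩ halfPlane`, flat vertices a `halfPlane`, `240°/300°` corners `halfPlane ∪ halfPlane`,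
  exactly the shapes of `IsCornerAt` / `IsFlatSideAt`.

Sources: folklore plane geometry.  No proposition is defined and no named fact is introduced.
-/

noncomputable section

open scoped ComplexConjugate
open Set

namespace Summit.CriticalPhenomena.SAWScalingLimit.Theorems.PolygonParitySqueeze

/-! ### 1. Linear relations between the six levels -/

/-- **The six inner normals are linear in two of them**: `n₁ = -n₀`, `n₃ = -n₂`, `n₅ = -n₄`,
`n₄ = n₀ + n₂`. [folklore] -/
theorem innerNormal_rel : innerNormal 1 = -innerNormal 0 ∧ innerNormal 3 = -innerNormal 2 ∧
    innerNormal 5 = -innerNormal 4 ∧ innerNormal 4 = innerNormal 0 + innerNormal 2 := by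
  refine ⟨by simp [innerNormal_eq], by simp [innerNormal_eq], by simp [innerNormal_eq], ?_⟩
  simp only [innerNormal_eq, Matrix.cons_val]
  apply Complex.ext <;> norm_num

/-- The signed levels inherit the relations: `ℓ₁ = -ℓ₀`, `ℓ₃ = -ℓ₂`, `ℓ₅ = -ℓ₄`, `ℓ₄ = ℓ₀ + ℓ₂`.
[folklore] -/
theorem level_rel (w : ℂ) :
    (w * conj (innerNormal 1)).re = -(w * conj (innerNormal 0)).re ∧
    (w * conj (innerNormal 3)).re = -(w * conj (innerNormal 2)).re ∧
    (w * conj (innerNormal 5)).re = -(w * conj (innerNormal 4)).re ∧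
    (w * conj (innerNormal 4)).re = (w * conj (innerNormal 0)).re + (w * conj (innerNormal 2)).re := by
  obtain ⟨h1, h3, h5, h4⟩ := innerNormal_rel
  refine ⟨?_, ?_, ?_, ?_⟩
  · rw [h1, map_neg, mul_neg, Complex.neg_re]
  · rw [h3, map_neg, mul_neg, Complex.neg_re]
  · rw [h5, map_neg, mul_neg, Complex.neg_re]
  · rw [h4, map_add, mul_add, Complex.add_re]

/-! ### 2. Interiors of closed zigzag half-planes, their intersections and unions -/

/-- Moving against the inner normal lowers the level: `ℓ_k(w - t·n_k) = ℓ_k(w) - t`. [folklore] -/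
theorem level_sub_smul_normal (k : Fin 6) (w : ℂ) (t : ℝ) :
    ((w - (t : ℂ) * innerNormal k) * conj (innerNormal k)).re = (w * conj (innerNormal k)).re - t := by
  rw [sub_mul, Complex.sub_re, mul_assoc, Complex.re_ofReal_mul, re_innerNormal_mul_conj, mul_one]

/-- **Interior of a closed zigzag half-plane** is the open one. [folklore] -/
theorem interior_closedHalfPlane (k : Fin 6) (c : ℂ) :
    interior {z : ℂ | 0 ≤ ((z - c) * conj (innerNormal k)).re} = halfPlane k c := by
  apply Subset.antisymm
  · intro z hz
    rw [mem_interior_iff_mem_nhds, Metric.mem_nhds_iff] at hz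
    obtain ⟨ε, hε, hball⟩ := hz
    rw [mem_halfPlane_iff_level]
    by_contra hle
    push Not at hle
    -- step against the normal by `ε/2`
    have hmem : z - ((ε / 2 : ℝ) : ℂ) * innerNormal k ∈ Metric.ball z ε := by
      rw [Metric.mem_ball, dist_eq_norm, sub_sub_cancel_left, norm_neg, norm_mul, norm_innerNormal,
        mul_one, Complex.norm_real, Real.norm_of_nonneg (by positivity)]
      linarith
    have h := hball hmem
    simp only [mem_setOf_eq] at h
    rw [show z - ((ε / 2 : ℝ) : ℂ) * innerNormal k - c = (z - c) - ((ε / 2 : ℝ) : ℂ) * innerNormal k by ring,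
      level_sub_smul_normal] at h
    linarith
  · have hopen : IsOpen (halfPlane k c) := by
      have : Continuous fun z : ℂ => ((z - c) * conj (innerNormal k)).re := by fun_prop
      exact isOpen_lt continuous_const this
    exact interior_maximal (fun z hz => le_of_lt ((mem_halfPlane_iff_level k c z).1 hz)) hopen

/-- **Interior of the intersection of two closed zigzag half-planes** (convex corners). [folklore] -/
theorem interior_inter_closedHalfPlane (k k' : Fin 6) (c : ℂ) :
    interior ({z : ℂ | 0 ≤ ((z - c) * conj (innerNormal k)).re} ∩
      {z : ℂ | 0 ≤ ((z - c) * conj (innerNormal k')).re}) = halfPlane k c ∩ halfPlane k' c := by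
  rw [interior_inter, interior_closedHalfPlane, interior_closedHalfPlane]

/-- **Interior of the union of two closed zigzag half-planes with distinct boundary lines** (reflex
corners): a common descent direction `v` (`ℓ_k(v) < 0`, `ℓ_k'(v) < 0`) shows that no point of both
boundary half-lines is interior. [folklore] -/
theorem interior_union_closedHalfPlane (k k' : Fin 6) (c v : ℂ)
    (hv : (v * conj (innerNormal k)).re < 0) (hv' : (v * conj (innerNormal k')).re < 0) :
    interior ({z : ℂ | 0 ≤ ((z - c) * conj (innerNormal k)).re} ∪
      {z : ℂ | 0 ≤ ((z - c) * conj (innerNormal k')).re}) = halfPlane k c ∪ halfPlane k' c := by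
  apply Subset.antisymm
  · intro z hz
    rw [mem_interior_iff_mem_nhds, Metric.mem_nhds_iff] at hz
    obtain ⟨ε, hε, hball⟩ := hz
    by_contra hzn
    simp only [mem_union, mem_halfPlane_iff_level, not_or, not_lt] at hzn
    -- step along `v`, scaled into the ball
    have hv0 : v ≠ 0 := by rintro rfl; simp at hv
    set t : ℝ := ε / 2 / ‖v‖ with ht
    have htpos : 0 < t := by rw [ht]; positivity
    have hmem : z + (t : ℂ) * v ∈ Metric.ball z ε := by
      rw [Metric.mem_ball, dist_eq_norm, add_sub_cancel_left, norm_mul, Complex.norm_real,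
        Real.norm_of_nonneg htpos.le, ht, div_mul_cancel₀ _ (norm_ne_zero_iff.2 hv0)]
      linarith
    have h := hball hmem
    have e : ∀ n : ℂ, ((z + (t : ℂ) * v - c) * conj n).re = ((z - c) * conj n).re + t * (v * conj n).re := by
      intro n
      rw [show z + (t : ℂ) * v - c = (z - c) + (t : ℂ) * v by ring, add_mul, Complex.add_re, mul_assoc,
        Complex.re_ofReal_mul]
    simp only [mem_union, mem_setOf_eq, e] at h
    rcases h with h | h
    · nlinarith [hzn.1, mul_neg_of_pos_of_neg htpos hv]
    · nlinarith [hzn.2, mul_neg_of_pos_of_neg htpos hv']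
  · have hopen : IsOpen (halfPlane k c ∪ halfPlane k' c) := by
      have h1 : Continuous fun z : ℂ => ((z - c) * conj (innerNormal k)).re := by fun_prop
      have h2 : Continuous fun z : ℂ => ((z - c) * conj (innerNormal k')).re := by fun_prop
      exact (isOpen_lt continuous_const h1).union (isOpen_lt continuous_const h2)
    refine interior_maximal ?_ hopen
    rintro z (hz | hz)
    · exact Or.inl (le_of_lt ((mem_halfPlane_iff_level k c z).1 hz))
    · exact Or.inr (le_of_lt ((mem_halfPlane_iff_level k' c z).1 hz))

/-! ### 3. The fan algebra of the six closed wedges -/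

/-- Simp forms of the level relations. [folklore] -/
theorem level_one_eq (w : ℂ) : (w * conj (innerNormal 1)).re = -(w * conj (innerNormal 0)).re :=
  (level_rel w).1
/-- Simp forms of the level relations. [folklore] -/
theorem level_three_eq (w : ℂ) : (w * conj (innerNormal 3)).re = -(w * conj (innerNormal 2)).re :=
  (level_rel w).2.1
/-- Simp forms of the level relations. [folklore] -/
theorem level_five_eq (w : ℂ) :
    (w * conj (innerNormal 5)).re = -((w * conj (innerNormal 0)).re + (w * conj (innerNormal 2)).re) := by
  rw [(level_rel w).2.2.1, (level_rel w).2.2.2]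
/-- Simp forms of the level relations. [folklore] -/
theorem level_four_eq (w : ℂ) :
    (w * conj (innerNormal 4)).re = (w * conj (innerNormal 0)).re + (w * conj (innerNormal 2)).re :=
  (level_rel w).2.2.2

/-- **The closed zigzag half-plane** of form `k` through `c` (data: a set): `{0 ≤ Re((z - c)·conj n_k)}`,
the closure side of `halfPlane k c`. [folklore] -/
def closedHalfPlane (k : Fin 6) (c : ℂ) : Set ℂ := {z : ℂ | 0 ≤ ((z - c) * conj (innerNormal k)).re}

/-- Membership in the closed half-plane. [folklore] -/
theorem mem_closedHalfPlane (k : Fin 6) (c z : ℂ) :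
    z ∈ closedHalfPlane k c ↔ 0 ≤ ((z - c) * conj (innerNormal k)).re := Iff.rfl

/-- **Two consecutive closed wedges make a closed `120°` wedge**: with the closed wedge `k` round `c`
being `closedHalfPlane (a k) c ∩ closedHalfPlane (b k) c`, `a = ![2,3,5,3,2,4]`, `b = ![0,4,0,1,5,1]`
(the `k`-th cell round a vertex, `…LocalCells`), the union of the wedges `k, k+1` is
`closedHalfPlane (p k) c ∩ closedHalfPlane (q k) c`, `p = ![0,3,3,1,2,4]`, `q = ![4,0,5,5,1,2]`.
[folklore] -/
theorem fan_two_eq (k : Fin 6) (c : ℂ) :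
    (closedHalfPlane (![2, 3, 5, 3, 2, 4] k) c ∩ closedHalfPlane (![0, 4, 0, 1, 5, 1] k) c) ∪
      (closedHalfPlane (![2, 3, 5, 3, 2, 4] (k + 1)) c ∩ closedHalfPlane (![0, 4, 0, 1, 5, 1] (k + 1)) c) =
    closedHalfPlane (![0, 3, 3, 1, 2, 4] k) c ∩ closedHalfPlane (![4, 0, 5, 5, 1, 2] k) c := by
  ext z
  fin_cases k <;>
    simp [-Complex.mul_re, -Complex.sub_re, -Complex.mul_im, -Complex.sub_im, closedHalfPlane, level_one_eq, level_three_eq, level_four_eq, level_five_eq] <;>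
    generalize ((z - c) * conj (innerNormal 0)).re = U at * <;>
    generalize ((z - c) * conj (innerNormal 2)).re = W at * <;>
    (constructor <;>
      [(rintro (⟨h1, h2⟩ | ⟨h1, h2⟩) <;> exact ⟨by linarith, by linarith⟩);
       (rintro ⟨h1, h2⟩
        rcases le_or_gt 0 U with hu | hu <;> rcases le_or_gt 0 W with hw | hw <;>
          rcases le_or_gt 0 (U + W) with huw | huw <;>
          first
          | exact Or.inl ⟨by linarith, by linarith⟩
          | exact Or.inr ⟨by linarith, by linarith⟩)])

/-- **Three consecutive closed wedges make a closed half-plane**: the union of the wedges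
`k, k+1, k+2` is `closedHalfPlane (h k) c`, `h = ![0,3,5,1,2,4]`. [folklore] -/
theorem fan_three_eq (k : Fin 6) (c : ℂ) :
    (closedHalfPlane (![2, 3, 5, 3, 2, 4] k) c ∩ closedHalfPlane (![0, 4, 0, 1, 5, 1] k) c) ∪
      (closedHalfPlane (![2, 3, 5, 3, 2, 4] (k + 1)) c ∩ closedHalfPlane (![0, 4, 0, 1, 5, 1] (k + 1)) c) ∪
      (closedHalfPlane (![2, 3, 5, 3, 2, 4] (k + 2)) c ∩ closedHalfPlane (![0, 4, 0, 1, 5, 1] (k + 2)) c) =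
    closedHalfPlane (![0, 3, 5, 1, 2, 4] k) c := by
  ext z
  fin_cases k <;>
    simp [-Complex.mul_re, -Complex.sub_re, -Complex.mul_im, -Complex.sub_im, closedHalfPlane, level_one_eq, level_three_eq, level_four_eq, level_five_eq] <;>
    generalize ((z - c) * conj (innerNormal 0)).re = U at * <;>
    generalize ((z - c) * conj (innerNormal 2)).re = W at * <;>
    (constructor <;>
      [(rintro ((⟨h1, h2⟩ | ⟨h1, h2⟩) | ⟨h1, h2⟩) <;> linarith);
       (intro h
        rcases le_or_gt 0 U with hu | hu <;> rcases le_or_gt 0 W with hw | hw <;>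
          rcases le_or_gt 0 (U + W) with huw | huw <;>
          first
          | exact Or.inl (Or.inl ⟨by linarith, by linarith⟩)
          | exact Or.inl (Or.inr ⟨by linarith, by linarith⟩)
          | exact Or.inr ⟨by linarith, by linarith⟩)])

/-- **Four consecutive closed wedges make the union of two closed half-planes** (reflex `240°`
corner): wedges `k, …, k+3` give `closedHalfPlane (h k) c ∪ closedHalfPlane (h (k+1)) c`. [folklore] -/
theorem fan_four_eq (k : Fin 6) (c : ℂ) :
    (closedHalfPlane (![2, 3, 5, 3, 2, 4] k) c ∩ closedHalfPlane (![0, 4, 0, 1, 5, 1] k) c) ∪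
      (closedHalfPlane (![2, 3, 5, 3, 2, 4] (k + 1)) c ∩ closedHalfPlane (![0, 4, 0, 1, 5, 1] (k + 1)) c) ∪
      (closedHalfPlane (![2, 3, 5, 3, 2, 4] (k + 2)) c ∩ closedHalfPlane (![0, 4, 0, 1, 5, 1] (k + 2)) c) ∪
      (closedHalfPlane (![2, 3, 5, 3, 2, 4] (k + 3)) c ∩ closedHalfPlane (![0, 4, 0, 1, 5, 1] (k + 3)) c) =
    closedHalfPlane (![0, 3, 5, 1, 2, 4] k) c ∪ closedHalfPlane (![0, 3, 5, 1, 2, 4] (k + 1)) c := by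
  ext z
  fin_cases k <;>
    simp [-Complex.mul_re, -Complex.sub_re, -Complex.mul_im, -Complex.sub_im, closedHalfPlane, level_one_eq, level_three_eq, level_four_eq, level_five_eq] <;>
    generalize ((z - c) * conj (innerNormal 0)).re = U at * <;>
    generalize ((z - c) * conj (innerNormal 2)).re = W at * <;>
    (constructor <;>
      [(rintro (((⟨h1, h2⟩ | ⟨h1, h2⟩) | ⟨h1, h2⟩) | ⟨h1, h2⟩) <;>
          first
          | exact Or.inl (by linarith)
          | exact Or.inr (by linarith));
       (rintro (h | h) <;>
        rcases le_or_gt 0 U with hu | hu <;> rcases le_or_gt 0 W with hw | hw <;>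
          rcases le_or_gt 0 (U + W) with huw | huw <;>
          first
          | exact Or.inl (Or.inl (Or.inl ⟨by linarith, by linarith⟩))
          | exact Or.inl (Or.inl (Or.inr ⟨by linarith, by linarith⟩))
          | exact Or.inl (Or.inr ⟨by linarith, by linarith⟩)
          | exact Or.inr ⟨by linarith, by linarith⟩)])

/-- **Five consecutive closed wedges make the union of two closed half-planes** (reflex `300°`
corner): wedges `k, …, k+4` give `closedHalfPlane (h k) c ∪ closedHalfPlane (h (k+2)) c`. [folklore] -/
theorem fan_five_eq (k : Fin 6) (c : ℂ) :
    (closedHalfPlane (![2, 3, 5, 3, 2, 4] k) c ∩ closedHalfPlane (![0, 4, 0, 1, 5, 1] k) c) ∪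
      (closedHalfPlane (![2, 3, 5, 3, 2, 4] (k + 1)) c ∩ closedHalfPlane (![0, 4, 0, 1, 5, 1] (k + 1)) c) ∪
      (closedHalfPlane (![2, 3, 5, 3, 2, 4] (k + 2)) c ∩ closedHalfPlane (![0, 4, 0, 1, 5, 1] (k + 2)) c) ∪
      (closedHalfPlane (![2, 3, 5, 3, 2, 4] (k + 3)) c ∩ closedHalfPlane (![0, 4, 0, 1, 5, 1] (k + 3)) c) ∪
      (closedHalfPlane (![2, 3, 5, 3, 2, 4] (k + 4)) c ∩ closedHalfPlane (![0, 4, 0, 1, 5, 1] (k + 4)) c) =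
    closedHalfPlane (![0, 3, 5, 1, 2, 4] k) c ∪ closedHalfPlane (![0, 3, 5, 1, 2, 4] (k + 2)) c := by
  ext z
  fin_cases k <;>
    simp [-Complex.mul_re, -Complex.sub_re, -Complex.mul_im, -Complex.sub_im, closedHalfPlane, level_one_eq, level_three_eq, level_four_eq, level_five_eq] <;>
    generalize ((z - c) * conj (innerNormal 0)).re = U at * <;>
    generalize ((z - c) * conj (innerNormal 2)).re = W at * <;>
    (constructor <;>
      [(rintro ((((⟨h1, h2⟩ | ⟨h1, h2⟩) | ⟨h1, h2⟩) | ⟨h1, h2⟩) | ⟨h1, h2⟩) <;>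
          first
          | exact Or.inl (by linarith)
          | exact Or.inr (by linarith));
       (rintro (h | h) <;>
        rcases le_or_gt 0 U with hu | hu <;> rcases le_or_gt 0 W with hw | hw <;>
          rcases le_or_gt 0 (U + W) with huw | huw <;>
          first
          | exact Or.inl (Or.inl (Or.inl (Or.inl ⟨by linarith, by linarith⟩)))
          | exact Or.inl (Or.inl (Or.inl (Or.inr ⟨by linarith, by linarith⟩)))
          | exact Or.inl (Or.inl (Or.inr ⟨by linarith, by linarith⟩))
          | exact Or.inl (Or.inr ⟨by linarith, by linarith⟩)
          | exact Or.inr ⟨by linarith, by linarith⟩)])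

/-! ### 4. Interiors of the fans -/

/-- **Interior of a fan of two** (convex `120°` corner): the open `halfPlane`s. [folklore] -/
theorem interior_fan_two (k : Fin 6) (c : ℂ) :
    interior ((closedHalfPlane (![2, 3, 5, 3, 2, 4] k) c ∩ closedHalfPlane (![0, 4, 0, 1, 5, 1] k) c) ∪ (closedHalfPlane (![2, 3, 5, 3, 2, 4] (k + 1)) c ∩ closedHalfPlane (![0, 4, 0, 1, 5, 1] (k + 1)) c)) =
      halfPlane (![0, 3, 3, 1, 2, 4] k) c ∩ halfPlane (![4, 0, 5, 5, 1, 2] k) c := by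
  rw [fan_two_eq]
  exact interior_inter_closedHalfPlane _ _ c

/-- **Interior of a single closed wedge** (convex `60°` corner). [folklore] -/
theorem interior_fan_one (k : Fin 6) (c : ℂ) :
    interior (closedHalfPlane (![2, 3, 5, 3, 2, 4] k) c ∩ closedHalfPlane (![0, 4, 0, 1, 5, 1] k) c) = halfPlane (![2, 3, 5, 3, 2, 4] k) c ∩ halfPlane (![0, 4, 0, 1, 5, 1] k) c :=
  interior_inter_closedHalfPlane _ _ c

/-- **Interior of a fan of three** (flat vertex): the open `halfPlane`. [folklore] -/
theorem interior_fan_three (k : Fin 6) (c : ℂ) :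
    interior ((closedHalfPlane (![2, 3, 5, 3, 2, 4] k) c ∩ closedHalfPlane (![0, 4, 0, 1, 5, 1] k) c) ∪ (closedHalfPlane (![2, 3, 5, 3, 2, 4] (k + 1)) c ∩ closedHalfPlane (![0, 4, 0, 1, 5, 1] (k + 1)) c) ∪ (closedHalfPlane (![2, 3, 5, 3, 2, 4] (k + 2)) c ∩ closedHalfPlane (![0, 4, 0, 1, 5, 1] (k + 2)) c)) = halfPlane (![0, 3, 5, 1, 2, 4] k) c := by
  rw [fan_three_eq]
  exact interior_closedHalfPlane _ c

/-- **Interior of a fan of four** (reflex `240°` corner): the union of the two open `halfPlane`s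
(descent direction `-(n + n')` for the two normals, `60°` apart). [folklore] -/
theorem interior_fan_four (k : Fin 6) (c : ℂ) :
    interior ((closedHalfPlane (![2, 3, 5, 3, 2, 4] k) c ∩ closedHalfPlane (![0, 4, 0, 1, 5, 1] k) c) ∪ (closedHalfPlane (![2, 3, 5, 3, 2, 4] (k + 1)) c ∩ closedHalfPlane (![0, 4, 0, 1, 5, 1] (k + 1)) c) ∪ (closedHalfPlane (![2, 3, 5, 3, 2, 4] (k + 2)) c ∩ closedHalfPlane (![0, 4, 0, 1, 5, 1] (k + 2)) c) ∪ (closedHalfPlane (![2, 3, 5, 3, 2, 4] (k + 3)) c ∩ closedHalfPlane (![0, 4, 0, 1, 5, 1] (k + 3)) c)) =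
      halfPlane (![0, 3, 5, 1, 2, 4] k) c ∪ halfPlane (![0, 3, 5, 1, 2, 4] (k + 1)) c := by
  rw [fan_four_eq]
  have h3 : Real.sqrt 3 * Real.sqrt 3 = 3 := Real.mul_self_sqrt (by norm_num)
  refine interior_union_closedHalfPlane _ _ c
    (-(innerNormal (![0, 3, 5, 1, 2, 4] k) + innerNormal (![0, 3, 5, 1, 2, 4] (k + 1)))) ?_ ?_ <;>
    fin_cases k <;> simp [innerNormal_eq] <;> nlinarith [h3]

/-- **Interior of a fan of five** (reflex `300°` corner): the union of the two open `halfPlane`s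
(descent direction `-(n + n')`, normals `120°` apart). [folklore] -/
theorem interior_fan_five (k : Fin 6) (c : ℂ) :
    interior ((closedHalfPlane (![2, 3, 5, 3, 2, 4] k) c ∩ closedHalfPlane (![0, 4, 0, 1, 5, 1] k) c) ∪ (closedHalfPlane (![2, 3, 5, 3, 2, 4] (k + 1)) c ∩ closedHalfPlane (![0, 4, 0, 1, 5, 1] (k + 1)) c) ∪ (closedHalfPlane (![2, 3, 5, 3, 2, 4] (k + 2)) c ∩ closedHalfPlane (![0, 4, 0, 1, 5, 1] (k + 2)) c) ∪ (closedHalfPlane (![2, 3, 5, 3, 2, 4] (k + 3)) c ∩ closedHalfPlane (![0, 4, 0, 1, 5, 1] (k + 3)) c) ∪ (closedHalfPlane (![2, 3, 5, 3, 2, 4] (k + 4)) c ∩ closedHalfPlane (![0, 4, 0, 1, 5, 1] (k + 4)) c)) =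
      halfPlane (![0, 3, 5, 1, 2, 4] k) c ∪ halfPlane (![0, 3, 5, 1, 2, 4] (k + 2)) c := by
  rw [fan_five_eq]
  have h3 : Real.sqrt 3 * Real.sqrt 3 = 3 := Real.mul_self_sqrt (by norm_num)
  refine interior_union_closedHalfPlane _ _ c
    (-(innerNormal (![0, 3, 5, 1, 2, 4] k) + innerNormal (![0, 3, 5, 1, 2, 4] (k + 2)))) ?_ ?_ <;>
    fin_cases k <;> simp [innerNormal_eq] <;> nlinarith [h3]

/-- **The interiors of the five fans** (registered form, sub-goal of `stub_innerPolygons`, FACT 3b):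
a fan of `1, 2, 3, 4, 5` consecutive closed `60°` wedges round `c` has interior
`halfPlane ∩ halfPlane` (`60°`, `120°`), `halfPlane` (`180°`), `halfPlane ∪ halfPlane` (`240°`,
`300°`) — the shapes of `IsCornerAt` / `IsFlatSideAt`. [folklore] -/
theorem fan_interiors : ∀ (k : Fin 6) (c : ℂ), interior (closedHalfPlane (![2, 3, 5, 3, 2, 4] k) c ∩ closedHalfPlane (![0, 4, 0, 1, 5, 1] k) c) = halfPlane (![2, 3, 5, 3, 2, 4] k) c ∩ halfPlane (![0, 4, 0, 1, 5, 1] k) c ∧ interior ((closedHalfPlane (![2, 3, 5, 3, 2, 4] k) c ∩ closedHalfPlane (![0, 4, 0, 1, 5, 1] k) c) ∪ (closedHalfPlane (![2, 3, 5, 3, 2, 4] (k + 1)) c ∩ closedHalfPlane (![0, 4, 0, 1, 5, 1] (k + 1)) c)) = halfPlane (![0, 3, 3, 1, 2, 4] k) c ∩ halfPlane (![4, 0, 5, 5, 1, 2] k) c ∧ interior ((closedHalfPlane (![2, 3, 5, 3, 2, 4] k) c ∩ closedHalfPlane (![0, 4, 0, 1, 5, 1] k) c) ∪ (closedHalfPlane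 (![2, 3, 5, 3, 2, 4] (k + 1)) c ∩ closedHalfPlane (![0, 4, 0, 1, 5, 1] (k + 1)) c) ∪ (closedHalfPlane (![2, 3, 5, 3, 2, 4] (k + 2)) c ∩ closedHalfPlane (![0, 4, 0, 1, 5, 1] (k + 2)) c)) = halfPlane (![0, 3, 5, 1, 2, 4] k) c ∧ interior ((closedHalfPlane (![2, 3, 5, 3, 2, 4] k) c ∩ closedHalfPlane (![0, 4, 0, 1, 5, 1] k) c) ∪ (closedHalfPlane (![2, 3, 5, 3, 2, 4] (k + 1)) c ∩ closedHalfPlane (![0, 4, 0, 1, 5, 1] (k + 1)) c) ∪ (closedHalfPlane (![2, 3, 5, 3, 2, 4] (k + 2)) c ∩ closedHalfPlane (![0, 4, 0, 1, 5, 1] (k + 2)) c) ∪ (closedHalfPlane (![2, 3, 5, 3, 2, 4] (k + 3)) c ∩ closedHalfPlane (![0, 4, 0, 1, 5, 1] (k + 3)) c)) = halfPlane (![0, 3, 5, 1, 2, 4] k) c ∪ halfPlane (![0, 3, 5, 1, 2, 4] (k + 1)) c ∧ interior ((closedHalfPlane (![2, 3, 5, 3, 2, 4] k) c ∩ closedHalfPlane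 (![0, 4, 0, 1, 5, 1] k) c) ∪ (closedHalfPlane (![2, 3, 5, 3, 2, 4] (k + 1)) c ∩ closedHalfPlane (![0, 4, 0, 1, 5, 1] (k + 1)) c) ∪ (closedHalfPlane (![2, 3, 5, 3, 2, 4] (k + 2)) c ∩ closedHalfPlane (![0, 4, 0, 1, 5, 1] (k + 2)) c) ∪ (closedHalfPlane (![2, 3, 5, 3, 2, 4] (k + 3)) c ∩ closedHalfPlane (![0, 4, 0, 1, 5, 1] (k + 3)) c) ∪ (closedHalfPlane (![2, 3, 5, 3, 2, 4] (k + 4)) c ∩ closedHalfPlane (![0, 4, 0, 1, 5, 1] (k + 4)) c)) = halfPlane (![0, 3, 5, 1, 2, 4] k) c ∪ halfPlane (![0, 3, 5, 1, 2, 4] (k + 2)) c :=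
  fun k c => ⟨interior_fan_one k c, interior_fan_two k c, interior_fan_three k c, interior_fan_four k c,
    interior_fan_five k c⟩

end Summit.CriticalPhenomena.SAWScalingLimit.Theorems.PolygonParitySqueeze

end
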